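import Summits.AtomisticToContinuum.FouriersLaw.Theses.EmbeddedDrudeMourre
import Literature.MathematicalPhysics.KineticTheory.PinnedChainResonantFinite
import Literature.Analysis.Calculus.ImplicitChart

/-!
# FGRGap, line `fold-jet-rigidity`, stub `stub_branchStructure` — part C: the analytic lift

Support for the registered stub `stub_branchStructure` (GA) of crux `EmbeddedDrudeMourre.FGRGap`
(item stmt-AtomisticToContinuum-12595).

`exists_lift`: at a simple root `y₀` of `Ω(a, ·, b)` (`∂₂Ω = v(y₀) - v(a + y₀ - b) ≠ 0`,
`v = groupVelocity ω₂ = ω'`) the analytic implicit function theorem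
(`ContDiffAt.implicitFunction` of Mathlib for the analytic map `((k₁,k₃),y) ↦ Ω(k₁,y,k₃)` on
`(ℝ × ℝ) × ℝ`, analyticity by `Literature.Analysis.Calculus.analyticAt_implicitFunction`) gives a
local solution `φ`, analytic at `(a,b)`, with `φ(a,b) = y₀`, `Ω(p.1, φ p, p.2) = 0` near `(a,b)`, and
— differentiating the implicit equation at every nearby point — the strict Fréchet derivative
`Dφ(p) = ((v₄ - v₁) dk₁ + (v₃ - v₄) dk₃)/(v₂ - v₄)`, `v₁ = v(p.1)`, `v₂ = v(φ p)`, `v₃ = v(p.2)`,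
`v₄ = v(p.1 + φ p - p.2)`.
-/

noncomputable section

open MeasureTheory Set Real Filter Topology
open scoped ENNReal ContDiff
open Literature.MathematicalPhysics.KineticTheory.PhononBoltzmann

namespace Summit.AtomisticToContinuum.FouriersLaw.Theorems.FGRGap.FoldJetRigidity.Branch

variable {ω₂ : ℝ}

/-- The group velocity `v = sin/ω` is continuous (`ω₂ > 0`). [folklore] -/
theorem continuous_groupVelocity (hω : 0 < ω₂) : Continuous (groupVelocity ω₂) := by
  have hd : Continuous (dispersion ω₂) :=
    continuous_iff_continuousAt.2 fun k => (hasDerivAt_dispersion hω k).continuousAt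
  exact continuous_sin.div hd fun k => (dispersion_pos hω k).ne'

/-- The band is real-analytic, hence `C^ω`. [folklore] -/
theorem contDiff_dispersion (hω : 0 < ω₂) : ContDiff ℝ ω (dispersion ω₂) :=
  contDiff_iff_contDiffAt.2 fun k => (analyticAt_dispersion hω k).contDiffAt

/-- The resonance function as a `C^ω` map of `((k₁, k₃), k₂) ∈ (ℝ × ℝ) × ℝ`. [folklore] -/
theorem contDiff_resonanceFn_prod (hω : 0 < ω₂) :
    ContDiff ℝ ω fun q : (ℝ × ℝ) × ℝ => resonanceFn ω₂ q.1.1 q.2 q.1.2 := by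
  have hd := contDiff_dispersion hω
  have c11 : ContDiff ℝ ω fun q : (ℝ × ℝ) × ℝ => q.1.1 := contDiff_fst.comp contDiff_fst
  have c12 : ContDiff ℝ ω fun q : (ℝ × ℝ) × ℝ => q.1.2 := contDiff_snd.comp contDiff_fst
  have c2 : ContDiff ℝ ω fun q : (ℝ × ℝ) × ℝ => q.2 := contDiff_snd
  unfold resonanceFn
  exact (((hd.comp c11).add (hd.comp c2)).sub (hd.comp c12)).sub (hd.comp ((c11.add c2).sub c12))

/-- The Fréchet derivative of `((k₁, k₃), k₂) ↦ Ω(k₁, k₂, k₃)`: a continuous linear form `F' q`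
with `F' q (w, t) = v₁ w.1 + v₂ t - v₃ w.2 - v₄ (w.1 + t - w.2)`. [folklore] -/
theorem exists_hasFDerivAt_resonanceFn_prod (hω : 0 < ω₂) :
    ∃ F' : (ℝ × ℝ) × ℝ → ((ℝ × ℝ) × ℝ →L[ℝ] ℝ),
      (∀ q, HasFDerivAt (fun q : (ℝ × ℝ) × ℝ => resonanceFn ω₂ q.1.1 q.2 q.1.2) (F' q) q) ∧
      (∀ q (w : ℝ × ℝ) (t : ℝ), F' q (w, t) =
        groupVelocity ω₂ q.1.1 * w.1 + groupVelocity ω₂ q.2 * t - groupVelocity ω₂ q.1.2 * w.2 -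
          groupVelocity ω₂ (q.1.1 + q.2 - q.1.2) * (w.1 + t - w.2)) := by
  refine ⟨fun q =>
    groupVelocity ω₂ q.1.1 •
        (ContinuousLinearMap.fst ℝ ℝ ℝ).comp (ContinuousLinearMap.fst ℝ (ℝ × ℝ) ℝ) +
      groupVelocity ω₂ q.2 • ContinuousLinearMap.snd ℝ (ℝ × ℝ) ℝ -
      groupVelocity ω₂ q.1.2 •
        (ContinuousLinearMap.snd ℝ ℝ ℝ).comp (ContinuousLinearMap.fst ℝ (ℝ × ℝ) ℝ) -
      groupVelocity ω₂ (q.1.1 + q.2 - q.1.2) •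
        ((ContinuousLinearMap.fst ℝ ℝ ℝ).comp (ContinuousLinearMap.fst ℝ (ℝ × ℝ) ℝ) +
          ContinuousLinearMap.snd ℝ (ℝ × ℝ) ℝ -
          (ContinuousLinearMap.snd ℝ ℝ ℝ).comp (ContinuousLinearMap.fst ℝ (ℝ × ℝ) ℝ)),
    fun q => ?_, fun q w t => ?_⟩
  · have h11 : HasFDerivAt (fun q : (ℝ × ℝ) × ℝ => q.1.1)
        ((ContinuousLinearMap.fst ℝ ℝ ℝ).comp (ContinuousLinearMap.fst ℝ (ℝ × ℝ) ℝ)) q :=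
      hasFDerivAt_fst.comp q hasFDerivAt_fst
    have h12 : HasFDerivAt (fun q : (ℝ × ℝ) × ℝ => q.1.2)
        ((ContinuousLinearMap.snd ℝ ℝ ℝ).comp (ContinuousLinearMap.fst ℝ (ℝ × ℝ) ℝ)) q :=
      hasFDerivAt_snd.comp q hasFDerivAt_fst
    have h2 : HasFDerivAt (fun q : (ℝ × ℝ) × ℝ => q.2) (ContinuousLinearMap.snd ℝ (ℝ × ℝ) ℝ) q :=
      hasFDerivAt_snd
    have h4 := (h11.add h2).sub h12
    have d1 := (hasDerivAt_dispersion hω q.1.1).comp_hasFDerivAt q h11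
    have d2 := (hasDerivAt_dispersion hω q.2).comp_hasFDerivAt q h2
    have d3 := (hasDerivAt_dispersion hω q.1.2).comp_hasFDerivAt q h12
    have d4 := (hasDerivAt_dispersion hω (q.1.1 + q.2 - q.1.2)).comp_hasFDerivAt q h4
    unfold resonanceFn
    exact ((d1.add d2).sub d3).sub d4
  · simp only [add_apply, sub_apply,
      smul_apply, ContinuousLinearMap.comp_apply,
      ContinuousLinearMap.coe_fst', ContinuousLinearMap.coe_snd', smul_eq_mul]

/-- **The analytic lift at a simple root.** If `Ω(a, y₀, b) = 0` and `v(y₀) ≠ v(a + y₀ - b)` then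
there is `φ : ℝ × ℝ → ℝ`, analytic at `(a, b)`, with `φ(a, b) = y₀`, `Ω(p.1, φ p, p.2) = 0` near
`(a, b)`, and the strict derivative `Dφ(p) = ((v₄ - v₁) dk₁ + (v₃ - v₄) dk₃)/(v₂ - v₄)` at every
`p` near `(a, b)` (implicit function theorem). [folklore] -/
theorem exists_lift (hω : 0 < ω₂) {a b y₀ : ℝ} (hz : resonanceFn ω₂ a y₀ b = 0)
    (hd : groupVelocity ω₂ y₀ ≠ groupVelocity ω₂ (a + y₀ - b)) :
    ∃ φ : ℝ × ℝ → ℝ, φ (a, b) = y₀ ∧ AnalyticAt ℝ φ (a, b) ∧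
      (∀ᶠ p in 𝓝 (a, b), resonanceFn ω₂ p.1 (φ p) p.2 = 0) ∧
      (∀ᶠ p in 𝓝 (a, b), HasStrictFDerivAt φ
        (((groupVelocity ω₂ (p.1 + φ p - p.2) - groupVelocity ω₂ p.1) /
              (groupVelocity ω₂ (φ p) - groupVelocity ω₂ (p.1 + φ p - p.2))) •
            ContinuousLinearMap.fst ℝ ℝ ℝ +
          ((groupVelocity ω₂ p.2 - groupVelocity ω₂ (p.1 + φ p - p.2)) /
              (groupVelocity ω₂ (φ p) - groupVelocity ω₂ (p.1 + φ p - p.2))) •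
            ContinuousLinearMap.snd ℝ ℝ ℝ) p) := by
  obtain ⟨F', hF, hFapp⟩ := exists_hasFDerivAt_resonanceFn_prod hω
  obtain ⟨f, hf⟩ : ∃ f : (ℝ × ℝ) × ℝ → ℝ, ∀ q, f q = resonanceFn ω₂ q.1.1 q.2 q.1.2 :=
    ⟨_, fun _ => rfl⟩
  have hfeq : f = fun q : (ℝ × ℝ) × ℝ => resonanceFn ω₂ q.1.1 q.2 q.1.2 := funext hf
  have hfc : ContDiff ℝ ω f := hfeq ▸ contDiff_resonanceFn_prod hω
  have hFf : ∀ q, HasFDerivAt f (F' q) q := fun q => hfeq ▸ hF q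
  have hfu : f ((a, b), y₀) = 0 := by rw [hf]; exact hz
  have cdf : ContDiffAt ℝ ω f ((a, b), y₀) := hfc.contDiffAt
  have hdu : groupVelocity ω₂ y₀ - groupVelocity ω₂ (a + y₀ - b) ≠ 0 := sub_ne_zero.2 hd
  have if₂ : (fderiv ℝ f ((a, b), y₀) ∘L ContinuousLinearMap.inr ℝ (ℝ × ℝ) ℝ).IsInvertible := by
    refine ⟨ContinuousLinearEquiv.unitsEquivAut ℝ (Units.mk0 _ hdu), ?_⟩
    apply ContinuousLinearMap.ext_ring
    rw [(hFf _).fderiv]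
    simp [hFapp]
  set ψ := cdf.implicitFunction Literature.Analysis.Calculus.omega_ne_zero if₂ with hψ
  have hψan : AnalyticAt ℝ ψ (a, b) :=
    Literature.Analysis.Calculus.analyticAt_implicitFunction cdf if₂
  have hψ0 : ψ (a, b) = y₀ := cdf.implicitFunction_apply_self _ if₂
  refine ⟨ψ, hψ0, hψan, ?_, ?_⟩
  · filter_upwards [cdf.eventually_apply_implicitFunction
      Literature.Analysis.Calculus.omega_ne_zero if₂] with p hp
    rw [hf, hfu] at hp
    exact hp
  · have han : ∀ᶠ p in 𝓝 (a, b), AnalyticAt ℝ ψ p := hψan.eventually_analyticAt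
    have hev : ∀ᶠ p in 𝓝 (a, b), ∀ᶠ p' in 𝓝 p, f (p', ψ p') = f ((a, b), y₀) :=
      Literature.Analysis.Calculus.eventually_eventually_apply_implicitFunction cdf if₂
    have hvc := continuous_groupVelocity hω
    have hcont : ContinuousAt ψ (a, b) := hψan.continuousAt
    have hdq : ∀ᶠ p : ℝ × ℝ in 𝓝 (a, b),
        groupVelocity ω₂ (ψ p) - groupVelocity ω₂ (p.1 + ψ p - p.2) ≠ 0 := by
      have hc : ContinuousAt (fun p : ℝ × ℝ =>
          groupVelocity ω₂ (ψ p) - groupVelocity ω₂ (p.1 + ψ p - p.2)) (a, b) :=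
        (hvc.continuousAt.comp hcont).sub
          (hvc.continuousAt.comp ((continuousAt_fst.add hcont).sub continuousAt_snd))
      apply hc.eventually_ne
      simpa only [hψ0] using hdu
    filter_upwards [han, hev, hdq] with p hp1 hp2 hp3
    have hDψ := hp1.differentiableAt.hasFDerivAt
    have hchain := (hFf (p, ψ p)).comp p ((hasFDerivAt_id p).prodMk hDψ)
    have hconst : HasFDerivAt (fun p' : ℝ × ℝ => f (p', ψ p')) (0 : ℝ × ℝ →L[ℝ] ℝ) p :=
      (hasFDerivAt_const (f ((a, b), y₀)) p).congr_of_eventuallyEq (hp2.mono fun p' h => h)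
    have hzero := hchain.unique hconst
    have key : fderiv ℝ ψ p =
        ((groupVelocity ω₂ (p.1 + ψ p - p.2) - groupVelocity ω₂ p.1) /
              (groupVelocity ω₂ (ψ p) - groupVelocity ω₂ (p.1 + ψ p - p.2))) •
            ContinuousLinearMap.fst ℝ ℝ ℝ +
          ((groupVelocity ω₂ p.2 - groupVelocity ω₂ (p.1 + ψ p - p.2)) /
              (groupVelocity ω₂ (ψ p) - groupVelocity ω₂ (p.1 + ψ p - p.2))) •
            ContinuousLinearMap.snd ℝ ℝ ℝ := by
      refine ContinuousLinearMap.ext fun w => ?_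
      have hw := congrArg (fun T : ℝ × ℝ →L[ℝ] ℝ => T w) hzero
      simp only [ContinuousLinearMap.comp_apply, ContinuousLinearMap.prod_apply,
        ContinuousLinearMap.id_apply, hFapp, zero_apply] at hw
      simp only [add_apply, smul_apply,
        ContinuousLinearMap.coe_fst', ContinuousLinearMap.coe_snd', smul_eq_mul]
      field_simp
      linear_combination hw
    rw [key] at hDψ
    exact hp1.contDiffAt.hasStrictFDerivAt' hDψ Literature.Analysis.Calculus.omega_ne_zero

end Branch

open Branch in
/-- **GA, part C (the analytic lift at a simple root).** If `Ω(a, y₀, b) = 0` and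
`v(y₀) ≠ v(a + y₀ - b)` then there is `φ : ℝ × ℝ → ℝ`, analytic at `(a, b)`, with `φ(a, b) = y₀`,
`Ω(p.1, φ p, p.2) = 0` near `(a, b)`, and the strict derivative
`Dφ(p) = ((v₄ - v₁) dk₁ + (v₃ - v₄) dk₃)/(v₂ - v₄)` at every `p` near `(a, b)`. [folklore] -/
theorem stub_branchStructure_partC :
    ∀ ω₂ : ℝ, 0 < ω₂ → ∀ a b y₀ : ℝ, resonanceFn ω₂ a y₀ b = 0 → groupVelocity ω₂ y₀ ≠ groupVelocity ω₂ (a + y₀ - b) → ∃ φ : ℝ × ℝ → ℝ, φ (a, b) = y₀ ∧ AnalyticAt ℝ φ (a, b) ∧ (∀ᶠ p in 𝓝 (a, b), resonanceFn ω₂ p.1 (φ p) p.2 = 0) ∧ (∀ᶠ p in 𝓝 (a, b), HasStrictFDerivAt φ (((groupVelocity ω₂ (p.1 + φ p - p.2) - groupVelocity ω₂ p.1) / (groupVelocity ω₂ (φ p) - groupVelocity ω₂ (p.1 + φ p - p.2))) • ContinuousLinearMap.fst ℝ ℝ ℝ + ((groupVelocity ω₂ p.2 - groupVelocity ω₂ (p.1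 + φ p - p.2)) / (groupVelocity ω₂ (φ p) - groupVelocity ω₂ (p.1 + φ p - p.2))) • ContinuousLinearMap.snd ℝ ℝ ℝ) p) :=
  fun _ hω _ _ _ hz hd => exists_lift hω hz hd

end Summit.AtomisticToContinuum.FouriersLaw.Theorems.FGRGap.FoldJetRigidity

end
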